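import Summits.QuantumFields.YangMills.Theorems.BalabanUVNodesN15KingModelTheorem21FreeField
import Summits.QuantumFields.YangMills.Theorems.BalabanUVNodesN15KingModelContinuumSymbolRate

/-!
# BalabanUVNodes ∕ N15 — THE KING-MODEL RUNG (PART Ϝ-c): THEOREM 2.1 (i) WITH A RATE — THE SYMBOL RATE `|S_{L^K}(q) − S_∞(p′(q))| ≤ C_S·L^{−2K}` AND
# `|ln Z^{ε_K}(T_{ε_K}, h) − ln Z(T, h)| ≤ ½C_S H²·|T|·ε_K²` (EXTENSIVE, RATE `ε_K²`) FOR THE FREE FIELD AT BLOCK-CONSTANT SOURCES; THE SAME FOR THE BLOCK-FIELD FUNCTIONALS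
# (Track A, DAG node N15 = NE2; FAN-OUT v1.1 §N15 s3 «KING-MODEL RUNG … NE2's analogue DECIDED in the model»)

HONEST FRAMING.  Count-neutral (cell `pub-ymgap`, seat `pub-ymgap-dag-n15-e` g33; `--supports stmt-QuantumFields-27366 --as helper` = K3⁸
`SpineGivenEndpointR13SepCoPHV`).  TEMPLATE LITERATURE: C. King, *The U(1) Higgs model. I. The continuum limit*, Commun. Math. Phys. **102** (1986) 649–677
[King1986] — KING's OWN `A = 0`, `g = 0` MODEL (free massive lattice scalar field) on the tori (2.21).  The printed Theorem 2.1 states the EXISTENCE of the limit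
(2.22); its proof (3.13) gives the rate `(L^kε_K)^{−β}ε_k^{min(σ,2β,γ)}`.  In the free model at block-constant sources the rate is `ε_K²`, extensive, with explicit
constants — proved here from part Ϡ-h's Lemma 4.3 at `n = ∞` (`abs_DeltaEff_sub_lim_le`) and the exact noise identity `a_K⁻¹ − a_∞⁻¹ = −L^{−2K}a_∞⁻¹`.  NOT the
U(1) Higgs model; NOT Bałaban's objects; NOT a node discharge (N15 is booked through n15-a's knit, untouched here); nothing continuum-Yang–Mills ∕ ℝ⁴ ∕ OS ∕ mass-gap ∕
Clay.  0 `sorry`; standard axioms; ONE definition (`symbolRateConst`, an explicit constant).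

THE MATHEMATICS.  With `Δ^{(K)}(p′) = (a_K⁻¹ + S_{L^K}(p′))⁻¹` ((4.5)) and `Δ^{(∞)}(p′) = (a_∞⁻¹ + S_∞(p′))⁻¹` (part Ϡ-c): `S_{L^K} − S_∞ = (1∕Δ^{(K)} − 1∕Δ^{(∞)}) −
(a_K⁻¹ − a_∞⁻¹)`.  Both symbols lie in `[δ_∞, a]`, `δ_∞ = (a_∞⁻¹ + m⁻²)⁻¹` (`a_K ≥ a_∞`, `S ≤ m⁻²` — parts Ϝ-a∕Ϝ-b), so `|1∕Δ^{(K)} − 1∕Δ^{(∞)}| ≤ δ_∞⁻²|Δ^{(K)} −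
Δ^{(∞)}| ≤ δ_∞⁻²C_Δ(a)L^{−2K}` (Ϡ-h: `C_Δ(a) = (8∕3)a²(a⁻¹ + π²∕48 + 1∕3) + (4∕3)a`), and `a_K⁻¹ − a_∞⁻¹ = −L^{−2K}∕a_∞` EXACTLY (`a_K⁻¹ = (1 − L^{−2K})∕(a(1 − L⁻²))`,
(2.13)).  Hence `|S_{L^K}(q) − S_∞(p′(q))| ≤ C_S·L^{−2K}`, `C_S(a, L, m²) = (a_∞⁻¹ + m⁻²)²C_Δ(a) + a_∞⁻¹`, for EVERY auxiliary `a > 0` (`S` does not depend on `a`;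
`a = 1` is used downstream).  Then, on a torus (2.21) with a source `|J_T| ≤ H`: `ln Z^{ε_K} − ln Z = ½|Ω_T|⁻¹Σ_q (S_{L^K}(q) − S_∞(p′(q)))|J̃_T(q)|²`, so
`|ln Z^{ε_K}(T_{ε_K}, J_T∘blk) − ln Z(T, J_T)| ≤ ½C_S·L^{−2K}·⟨J_T,J_T⟩ ≤ ½C_S H²·|T|·ε_K²` (Plancherel; `|Ω_T| = |T|`), and `|Z^{ε_K} − Z| ≤ |ln Z^{ε_K} − ln Z|(Z^{ε_K} + Z)
≤ C_S H²|T|ε_K²·e^{H²|T|∕(2m²)}` by the p.656 letter `|e^x − e^y| ≤ |x − y|(e^x + e^y)`.  The block-field functionals `Z′` (part Ϝ-b §3) differ from `Z^{ε_K}` by the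
noise factor `e^{|J|²∕(2a_K)}`, whose logarithm converges at the exact rate `L^{−2K}|J|²∕(2a_∞)`: `|ln Z′(T,K) − ln Z′(T)| ≤ ½(C_S + a_∞⁻¹)H²·|T|·ε_K²`.

WHAT THIS FILE PROVES (kernel).  §1 `inv_aK_sub_inv_aInf` (EXACT), `abs_inv_aK_sub_inv_aInf`, `DeltaEff_eq_inv_add_Sfib` (`Δ^{(K)}(p′(q)) = (a_K⁻¹ + S_{L^K}(q))⁻¹`),
`DeltaEff_ge_unif`, `effSymLim_ge_unif` (both `≥ δ_∞`), `symbolRateConst` + `_pos`, ★★★ **`abs_Sfib_sub_aliasSeries0_le`** (`|S_{L^K}(q) − S_∞(p′(q))| ≤ C_S L^{−2K}`,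
every `K ≥ 1`, every torus momentum, every unit torus).  §2 `eps_sq` (`ε_K² = L^{−2K}`), `abs_fourierSum_sub_le`, ★★★ **`abs_log_kingFreeZ_sub_log_lim_le`**
(`≤ ½C_S(1)H²·|T|·ε_K²`), ★★ `abs_kingFreeZ_sub_lim_le` (`Z`-level rate).  §3 `log_kingBlockZ_sub_log_lim_eq` (exact difference), ★★★ **`abs_log_kingBlockZ_sub_log_lim_le`**
(`≤ ½(C_S(a) + a_∞⁻¹)H²·|T|·ε_K²`).

HONEST SCOPE.  Free field, block-constant sources, odd `L ≥ 3` de facto, `m² > 0`, `K ≥ 1`; constants explicit but not optimised.  Theorem 2.1's rate for the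
U(1) Higgs model ((3.13)) is NOT claimed.  N15 untouched; counts unmoved.
Locators: [King1986] (2.13)–(2.15) p.653, Thm 2.1 (2.22)–(2.23) p.654, (3.11)–(3.13) p.656, Lemma 4.3 (4.18) p.672, (4.5) p.670, (4.35) p.674.
-/

noncomputable section

open scoped BigOperators
open Finset Matrix Filter Topology MeasureTheory

namespace Summit.QuantumFields.YangMills.BalabanUVNodes.N15KingModelRung

open Literature.MathematicalPhysics.QuantumFieldTheory.Balaban1983to89.B5Prop11Plancherel (Tor fine chi sOf)
open Literature.MathematicalPhysics.QuantumFieldTheory.King1986 (aK aK_pos aK_le inv_aK DeltaEff)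
open Literature.MathematicalPhysics.QuantumFieldTheory.King1986.Torus
open Literature.MathematicalPhysics.QuantumFieldTheory.King1986.ContinuumLimit (eps eps_pos Torus221 abs_exp_sub_exp_le)

variable {d : ℕ}

/-! ## §1 The symbol rate `|S_{L^K}(q) − S_∞(p′(q))| ≤ C_S·L^{−2K}` -/

section Symbol

variable (L : ℕ) (M : Fin (d + 1) → ℕ) [hM : ∀ μ, NeZero (M μ)]

omit hM in
/-- **EXACT**: `a_K⁻¹ − a_∞⁻¹ = −L^{−2K}·a_∞⁻¹` (`a_K⁻¹ = (1 − L^{−2K})∕(a(1 − L⁻²))`, `a_∞ = a(1 − L⁻²)`). [cite: King1986, (2.13) p.653, (4.12) p.671] -/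
theorem inv_aK_sub_inv_aInf {a : ℝ} (ha : 0 < a) (hL : 2 ≤ L) (K : ℕ) :
    (aK a L K)⁻¹ - (aInf a L)⁻¹ = -(((L : ℝ) ^ (2 * K))⁻¹ * (aInf a L)⁻¹) := by
  have hL1 : (1 : ℝ) < L := by exact_mod_cast (show 1 < L by omega)
  have hL2 : (1 : ℝ) < (L : ℝ) ^ 2 := by nlinarith
  have h1 : (1 : ℝ) - ((L : ℝ) ^ 2)⁻¹ ≠ 0 := by
    have : ((L : ℝ) ^ 2)⁻¹ < 1 := inv_lt_one_of_one_lt₀ hL2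
    linarith
  have hLK : (L : ℝ) ^ (2 * K) ≠ 0 := pow_ne_zero _ (by positivity)
  rw [inv_aK]
  unfold aInf
  field_simp
  ring

omit hM in
/-- `|a_K⁻¹ − a_∞⁻¹| = L^{−2K}a_∞⁻¹`. [cite: King1986, (2.13) p.653] -/
theorem abs_inv_aK_sub_inv_aInf {a : ℝ} (ha : 0 < a) (hL : 2 ≤ L) (K : ℕ) :
    |(aK a L K)⁻¹ - (aInf a L)⁻¹| = ((L : ℝ) ^ (2 * K))⁻¹ * (aInf a L)⁻¹ := by
  have hL1 : (1 : ℝ) < L := by exact_mod_cast (show 1 < L by omega)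
  rw [inv_aK_sub_inv_aInf L ha hL K, abs_neg, abs_of_nonneg]
  have := aInf_pos ha hL1
  positivity

/-- `Δ^{(K)}(p′(q)) = (a_K⁻¹ + S_{L^K}(q))⁻¹` — (4.5) through the tree's `effSym = a∕(1 + aS)`. [cite: King1986, (4.5) p.670] -/
theorem DeltaEff_eq_inv_add_Sfib (hL : 2 ≤ L) {a m2 : ℝ} (ha : 0 < a) (hm : 0 < m2) {K : ℕ} (hK : 1 ≤ K) (q : Tor M) :
    haveI : NeZero L := ⟨by omega⟩
    DeltaEff (aK a L K) (L ^ K) m2 (sOf M q) = ((aK a L K)⁻¹ + Sfib (L ^ K) M (((L ^ K : ℕ) : ℝ) ^ 2) m2 q)⁻¹ := by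
  haveI : NeZero L := ⟨by omega⟩
  have hL1 : (1 : ℝ) < L := by exact_mod_cast (show 1 < L by omega)
  have haK := aK_pos ha hL1 hK
  have hLK : 1 ≤ L ^ K := Nat.one_le_pow K L (by omega)
  rw [← effSym_eq_DeltaEff (L ^ K) M hLK haK hm q]
  unfold effSym
  have hS : 0 ≤ Sfib (L ^ K) M (((L ^ K : ℕ) : ℝ) ^ 2) m2 q := Sfib_nonneg (by positivity) hm q
  have h1 : 0 < 1 + aK a L K * Sfib (L ^ K) M (((L ^ K : ℕ) : ℝ) ^ 2) m2 q := by positivity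
  field_simp

/-- `Δ^{(K)}(p′(q)) ≥ δ_∞ = (a_∞⁻¹ + m⁻²)⁻¹`, uniformly in `K ≥ 1` (`a_K ≥ a_∞`, `S ≤ m⁻²`). [cite: King1986, (4.5) p.670, (4.8) p.671] -/
theorem DeltaEff_ge_unif (hL : 2 ≤ L) {a m2 : ℝ} (ha : 0 < a) (hm : 0 < m2) {K : ℕ} (hK : 1 ≤ K) (q : Tor M) :
    ((aInf a L)⁻¹ + m2⁻¹)⁻¹ ≤ DeltaEff (aK a L K) (L ^ K) m2 (sOf M q) := by
  haveI : NeZero L := ⟨by omega⟩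
  have hL1 : (1 : ℝ) < L := by exact_mod_cast (show 1 < L by omega)
  have haK := aK_pos ha hL1 hK
  have haI := aInf_pos ha hL1
  rw [DeltaEff_eq_inv_add_Sfib L M hL ha hm hK q]
  have hS : 0 ≤ Sfib (L ^ K) M (((L ^ K : ℕ) : ℝ) ^ 2) m2 q := Sfib_nonneg (by positivity) hm q
  refine inv_anti₀ (by positivity) (add_le_add ?_ (Sfib_le_inv_mass (L ^ K) M (by positivity) hm q))
  exact inv_anti₀ haI (aInf_le_aK ha hL1 hK)

/-- `Δ^{(∞)}(p′(q)) ≥ δ_∞` (sharp ceiling `S_∞ ≤ m⁻²`, part Ϝ-b). [cite: King1986, (4.5) p.670, (4.8) p.671] -/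
theorem effSymLim_ge_unif (hLodd : Odd L) (hL : 2 ≤ L) {a m2 : ℝ} (ha : 0 < a) (hm : 0 < m2) (q : Tor M) :
    ((aInf a L)⁻¹ + m2⁻¹)⁻¹ ≤ effSymLim a L m2 (sOf M q) := by
  have hL1 : (1 : ℝ) < L := by exact_mod_cast (show 1 < L by omega)
  have haI := aInf_pos ha hL1
  rw [effSymLim_eq_inv ha hL1 hm.le]
  have hS := aliasSeries0_nonneg hm.le (sOf M q)
  exact inv_anti₀ (by positivity) (add_le_add le_rfl (aliasSeries0_sOf_le_inv_mass L M hLodd hL hm q))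

omit hM in
/-- The explicit constant `C_S(a, L, m²) = (a_∞⁻¹ + m⁻²)²·C_Δ(a) + a_∞⁻¹`, `C_Δ(a) = (8∕3)a²(a⁻¹ + π²∕48 + 1∕3) + (4∕3)a`. [cite: King1986, Lemma 4.3 (4.18) p.672] -/
def symbolRateConst (a : ℝ) (L : ℕ) (m2 : ℝ) : ℝ :=
  ((aInf a L)⁻¹ + m2⁻¹) ^ 2 * (8 / 3 * (a ^ 2 * (a⁻¹ + Real.pi ^ 2 / 48 + 1 / 3)) + 4 / 3 * a) + (aInf a L)⁻¹

omit hM in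
/-- `C_S > 0`. [folklore] -/
theorem symbolRateConst_pos {a : ℝ} (ha : 0 < a) (hL : 2 ≤ L) (m2 : ℝ) (hm : 0 < m2) : 0 < symbolRateConst a L m2 := by
  have hL1 : (1 : ℝ) < L := by exact_mod_cast (show 1 < L by omega)
  have haI := aInf_pos ha hL1
  unfold symbolRateConst
  positivity

/-- ★★★ **THE SYMBOL RATE**: for odd `L ≥ 2`, `m² > 0`, `K ≥ 1`, every unit torus and every torus momentum,
`|S_{L^K}(q) − S_∞(p′(q))| ≤ C_S(a, L, m²)·L^{−2K}` — for EVERY auxiliary `a > 0`. [cite: King1986, Lemma 4.3 (4.18) p.672, (4.5) p.670, (2.13) p.653] -/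
theorem abs_Sfib_sub_aliasSeries0_le (hLodd : Odd L) (hL : 2 ≤ L) {a m2 : ℝ} (ha : 0 < a) (hm : 0 < m2) {K : ℕ} (hK : 1 ≤ K) (q : Tor M) :
    haveI : NeZero L := ⟨by omega⟩
    |Sfib (L ^ K) M (((L ^ K : ℕ) : ℝ) ^ 2) m2 q - aliasSeries0 m2 (sOf M q)| ≤ symbolRateConst a L m2 * ((L : ℝ) ^ (2 * K))⁻¹ := by
  haveI : NeZero L := ⟨by omega⟩
  have hL1 : (1 : ℝ) < L := by exact_mod_cast (show 1 < L by omega)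
  have haK := aK_pos ha hL1 hK
  have haI := aInf_pos ha hL1
  set x := DeltaEff (aK a L K) (L ^ K) m2 (sOf M q) with hx
  set y := effSymLim a L m2 (sOf M q) with hy
  set δ := ((aInf a L)⁻¹ + m2⁻¹)⁻¹ with hδ
  have hδpos : 0 < δ := by positivity
  have hxge : δ ≤ x := DeltaEff_ge_unif L M hL ha hm hK q
  have hyge : δ ≤ y := effSymLim_ge_unif L M hLodd hL ha hm q
  have hxpos : 0 < x := lt_of_lt_of_le hδpos hxge
  have hypos : 0 < y := lt_of_lt_of_le hδpos hyge
  -- `S_K = x⁻¹ − a_K⁻¹`, `S_∞ = y⁻¹ − a_∞⁻¹`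
  have hSK : Sfib (L ^ K) M (((L ^ K : ℕ) : ℝ) ^ 2) m2 q = x⁻¹ - (aK a L K)⁻¹ := by
    rw [hx, DeltaEff_eq_inv_add_Sfib L M hL ha hm hK q, inv_inv]; ring
  have hS0 : aliasSeries0 m2 (sOf M q) = y⁻¹ - (aInf a L)⁻¹ := by
    rw [hy, effSymLim_eq_inv ha hL1 hm.le, inv_inv]; ring
  have hrate : |x - y| ≤ (8 / 3 * (a ^ 2 * (a⁻¹ + Real.pi ^ 2 / 48 + 1 / 3)) + 4 / 3 * a) * ((L : ℝ) ^ (2 * K))⁻¹ :=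
    abs_DeltaEff_sub_lim_le L M hLodd hL ha hm hK q
  have hinv : |x⁻¹ - y⁻¹| ≤ δ⁻¹ ^ 2 * |x - y| := by
    rw [inv_sub_inv hxpos.ne' hypos.ne', abs_div, abs_of_pos (mul_pos hxpos hypos), abs_sub_comm]
    rw [div_le_iff₀ (mul_pos hxpos hypos)]
    have hxy : δ * δ ≤ x * y := mul_le_mul hxge hyge hδpos.le hxpos.le
    calc |x - y| = δ⁻¹ ^ 2 * |x - y| * (δ * δ) := by field_simp
      _ ≤ δ⁻¹ ^ 2 * |x - y| * (x * y) := by gcongr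
  have hnoise := abs_inv_aK_sub_inv_aInf L ha hL K
  calc |Sfib (L ^ K) M (((L ^ K : ℕ) : ℝ) ^ 2) m2 q - aliasSeries0 m2 (sOf M q)|
      = |(x⁻¹ - y⁻¹) - ((aK a L K)⁻¹ - (aInf a L)⁻¹)| := by rw [hSK, hS0]; ring_nf
    _ ≤ |x⁻¹ - y⁻¹| + |(aK a L K)⁻¹ - (aInf a L)⁻¹| := abs_sub _ _
    _ ≤ δ⁻¹ ^ 2 * ((8 / 3 * (a ^ 2 * (a⁻¹ + Real.pi ^ 2 / 48 + 1 / 3)) + 4 / 3 * a) * ((L : ℝ) ^ (2 * K))⁻¹)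
        + ((L : ℝ) ^ (2 * K))⁻¹ * (aInf a L)⁻¹ := by
        rw [hnoise]
        exact add_le_add (hinv.trans (mul_le_mul_of_nonneg_left hrate (by positivity))) le_rfl
    _ = symbolRateConst a L m2 * ((L : ℝ) ^ (2 * K))⁻¹ := by
        rw [symbolRateConst, hδ, inv_inv]; ring

end Symbol

/-! ## §2 The rate of (2.22) for the free field at block-constant sources -/

section FreeRate

variable (L : ℕ) [NeZero L] (m2 : ℝ)

omit [NeZero L] in
/-- `ε_K² = L^{−2K}`. [cite: King1986, (2.21) p.654] -/
theorem eps_sq (K : ℕ) : eps L K ^ 2 = ((L : ℝ) ^ (2 * K))⁻¹ := by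
  rw [eps, ← inv_pow, ← pow_mul, mul_comm, inv_pow]

/-- The plane-wave sums differ by at most `C_S L^{−2K}⟨J, J⟩`. [cite: King1986, Lemma 4.3 (4.18) p.672, (4.35) p.674] -/
theorem abs_fourierSum_sub_le (M : Fin (d + 1) → ℕ) [∀ μ, NeZero (M μ)] (hLodd : Odd L) (hL : 2 ≤ L) {a : ℝ} (ha : 0 < a) (hm : 0 < m2)
    {K : ℕ} (hK : 1 ≤ K) (J : Tor M → ℝ) :
    |(Fintype.card (Tor M) : ℝ)⁻¹ * ∑ q : Tor M, Sfib (L ^ K) M (((L ^ K : ℕ) : ℝ) ^ 2) m2 q * ‖ft M J q‖ ^ 2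
        - (Fintype.card (Tor M) : ℝ)⁻¹ * ∑ q : Tor M, aliasSeries0 m2 (sOf M q) * ‖ft M J q‖ ^ 2|
      ≤ symbolRateConst a L m2 * ((L : ℝ) ^ (2 * K))⁻¹ * (J ⬝ᵥ J) := by
  have hcard : (0 : ℝ) < Fintype.card (Tor M) := by exact_mod_cast Fintype.card_pos
  rw [← mul_sub, ← Finset.sum_sub_distrib, abs_mul, abs_of_pos (inv_pos.mpr hcard)]
  have hNZ : (⟨by omega⟩ : NeZero L) = ‹NeZero L› := Subsingleton.elim _ _
  calc (Fintype.card (Tor M) : ℝ)⁻¹ * |∑ q : Tor M, (Sfib (L ^ K) M (((L ^ K : ℕ) : ℝ) ^ 2) m2 q * ‖ft M J q‖ ^ 2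
          - aliasSeries0 m2 (sOf M q) * ‖ft M J q‖ ^ 2)|
      ≤ (Fintype.card (Tor M) : ℝ)⁻¹ * ∑ q : Tor M, symbolRateConst a L m2 * ((L : ℝ) ^ (2 * K))⁻¹ * ‖ft M J q‖ ^ 2 := by
        gcongr
        refine (Finset.abs_sum_le_sum_abs _ _).trans (Finset.sum_le_sum fun q _ => ?_)
        rw [← sub_mul, abs_mul, abs_of_nonneg (sq_nonneg ‖ft M J q‖)]
        gcongr
        have h := abs_Sfib_sub_aliasSeries0_le L M hLodd hL ha hm hK q
        exact h
    _ = symbolRateConst a L m2 * ((L : ℝ) ^ (2 * K))⁻¹ * (J ⬝ᵥ J) := by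
        rw [← Finset.mul_sum, ← parseval_dot]
        field_simp

/-- ★★★ **THEOREM 2.1 (i) WITH RATE `ε_K²`, EXTENSIVE**: for odd `L ≥ 2`, `m² > 0`, `K ≥ 1`, every torus (2.21) and every source family `|J_T| ≤ H`,
`|ln Z^{ε_K}(T_{ε_K}, J_T∘blk) − ln Z(T, J_T)| ≤ ½C_S(1, L, m²)H²·|T|·ε_K²`. [cite: King1986, Thm 2.1 (2.22) p.654, (3.13) p.656, Lemma 4.3 (4.18) p.672] -/
theorem abs_log_kingFreeZ_sub_log_lim_le (hLodd : Odd L) (hL : 2 ≤ L) (hm : 0 < m2) {J : ∀ T : Torus221 (d + 1), Tor (t221Sites T) → ℝ} {H : ℝ}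
    (hJ : ∀ T b, |J T b| ≤ H) (T : Torus221 (d + 1)) {K : ℕ} (hK : 1 ≤ K) :
    |Real.log (kingFreeZ L m2 J T K) - Real.log (kingFreeZlim m2 J T)| ≤ symbolRateConst 1 L m2 * H ^ 2 / 2 * T.vol * eps L K ^ 2 := by
  haveI := t221Sites_neZero T
  rw [kingFreeZ_eq L m2 hm J T K, Real.log_exp, log_kingFreeZlim_eq, ← mul_sub, abs_mul, abs_of_pos (by norm_num : (0 : ℝ) < 1 / 2), eps_sq,
    ← card_tor_t221Sites T]
  have h1 := abs_fourierSum_sub_le L m2 (t221Sites T) hLodd hL one_pos hm hK (J T)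
  have h2 := dotProduct_self_le_vol (t221Sites T) (hJ T)
  have hC := (symbolRateConst_pos L one_pos hL m2 hm).le
  calc (1 / 2 : ℝ) * |(Fintype.card (Tor (t221Sites T)) : ℝ)⁻¹ * ∑ q, Sfib (L ^ K) (t221Sites T) (((L ^ K : ℕ) : ℝ) ^ 2) m2 q * ‖ft (t221Sites T) (J T) q‖ ^ 2
          - (Fintype.card (Tor (t221Sites T)) : ℝ)⁻¹ * ∑ q, aliasSeries0 m2 (sOf (t221Sites T) q) * ‖ft (t221Sites T) (J T) q‖ ^ 2|
      ≤ (1 / 2 : ℝ) * (symbolRateConst 1 L m2 * ((L : ℝ) ^ (2 * K))⁻¹ * (J T ⬝ᵥ J T)) := by gcongr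
    _ ≤ (1 / 2 : ℝ) * (symbolRateConst 1 L m2 * ((L : ℝ) ^ (2 * K))⁻¹ * (H ^ 2 * Fintype.card (Tor (t221Sites T)))) := by gcongr
    _ = symbolRateConst 1 L m2 * H ^ 2 / 2 * Fintype.card (Tor (t221Sites T)) * ((L : ℝ) ^ (2 * K))⁻¹ := by ring

/-- ★★ **The `Z`-level rate** (the p.656 letter `|e^x − e^y| ≤ |x − y|(e^x + e^y)` with both logarithms `≤ H²|T|∕(2m²)`):
`|Z^{ε_K}(T_{ε_K}, J_T∘blk) − Z(T, J_T)| ≤ C_S(1)H²|T|ε_K² · e^{H²|T|∕(2m²)}`. [cite: King1986, Thm 2.1 (2.22) p.654, (3.11) p.656] -/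
theorem abs_kingFreeZ_sub_lim_le (hLodd : Odd L) (hL : 2 ≤ L) (hm : 0 < m2) {J : ∀ T : Torus221 (d + 1), Tor (t221Sites T) → ℝ} {H : ℝ}
    (hJ : ∀ T b, |J T b| ≤ H) (T : Torus221 (d + 1)) {K : ℕ} (hK : 1 ≤ K) :
    |kingFreeZ L m2 J T K - kingFreeZlim m2 J T|
      ≤ symbolRateConst 1 L m2 * H ^ 2 * T.vol * eps L K ^ 2 * Real.exp (H ^ 2 / (2 * m2) * T.vol) := by
  have hZK := kingFreeZ_pos L m2 hm J T K
  have hZ := kingFreeZlim_pos m2 J T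
  have hx := abs_log_kingFreeZ_le L m2 hm hJ T K
  have hy := abs_log_kingFreeZlim_le L m2 hLodd hL hm hJ T
  have hrate := abs_log_kingFreeZ_sub_log_lim_le L m2 hLodd hL hm hJ T hK
  have h := abs_exp_sub_exp_le (Real.log (kingFreeZ L m2 J T K)) (Real.log (kingFreeZlim m2 J T))
  rw [Real.exp_log hZK, Real.exp_log hZ] at h
  have hex : kingFreeZ L m2 J T K ≤ Real.exp (H ^ 2 / (2 * m2) * T.vol) := by
    rw [← Real.exp_log hZK]; exact Real.exp_le_exp.mpr (le_of_abs_le hx)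
  have hey : kingFreeZlim m2 J T ≤ Real.exp (H ^ 2 / (2 * m2) * T.vol) := by
    rw [← Real.exp_log hZ]; exact Real.exp_le_exp.mpr (le_of_abs_le hy)
  have hC := (symbolRateConst_pos L one_pos hL m2 hm).le
  have hvol := T.vol_pos.le
  calc |kingFreeZ L m2 J T K - kingFreeZlim m2 J T|
      ≤ |Real.log (kingFreeZ L m2 J T K) - Real.log (kingFreeZlim m2 J T)| * (kingFreeZ L m2 J T K + kingFreeZlim m2 J T) := h
    _ ≤ (symbolRateConst 1 L m2 * H ^ 2 / 2 * T.vol * eps L K ^ 2) * (Real.exp (H ^ 2 / (2 * m2) * T.vol) + Real.exp (H ^ 2 / (2 * m2) * T.vol)) := by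
        gcongr
    _ = symbolRateConst 1 L m2 * H ^ 2 * T.vol * eps L K ^ 2 * Real.exp (H ^ 2 / (2 * m2) * T.vol) := by ring

end FreeRate

/-! ## §3 The rate for the block-field functionals -/

section BlockRate

variable (L : ℕ) [NeZero L] (a m2 : ℝ)

/-- The exact difference: `ln Z′(T, K) − ln Z′(T) = ½[(a_K⁻¹ − a_∞⁻¹)⟨J,J⟩ + |Ω|⁻¹Σ_q (S_{L^K}(q) − S_∞(p′(q)))|J̃(q)|²]`.
[cite: King1986, (2.14) p.653, (4.5) p.670, (4.35) p.674] -/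
theorem log_kingBlockZ_sub_log_lim_eq (hLodd : Odd L) (hL : 2 ≤ L) (ha : 0 < a) (hm : 0 < m2) (J : ∀ T : Torus221 (d + 1), Tor (t221Sites T) → ℝ)
    (T : Torus221 (d + 1)) {K : ℕ} (hK : 1 ≤ K) :
    haveI := t221Sites_neZero T
    Real.log (kingBlockZ L a m2 J T K) - Real.log (kingBlockZlim L a m2 J T)
      = (1 / 2 : ℝ) * (((aK a L K)⁻¹ - (aInf a L)⁻¹) * (J T ⬝ᵥ J T)
          + ((Fintype.card (Tor (t221Sites T)) : ℝ)⁻¹ * ∑ q, Sfib (L ^ K) (t221Sites T) (((L ^ K : ℕ) : ℝ) ^ 2) m2 q * ‖ft (t221Sites T) (J T) q‖ ^ 2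
            - (Fintype.card (Tor (t221Sites T)) : ℝ)⁻¹ * ∑ q, aliasSeries0 m2 (sOf (t221Sites T) q) * ‖ft (t221Sites T) (J T) q‖ ^ 2)) := by
  haveI := t221Sites_neZero T
  have hL1 : (1 : ℝ) < L := by exact_mod_cast (show 1 < L by omega)
  have hLK : 1 ≤ L ^ K := Nat.one_le_pow K L (by omega)
  rw [kingBlockZ_eq_exp L a m2 hL ha hm J T hK, Real.log_exp, effLaplacian_inv_form (L ^ K) (t221Sites T) hLK (aK_pos ha hL1 hK) hm]
  unfold kingBlockZlim
  rw [Real.log_exp, blockCovLim_form L (t221Sites T) hLodd hL ha hm]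
  ring

/-- ★★★ **THE RATE FOR THE BLOCK-FIELD FUNCTIONALS**: `|ln Z′(T, K) − ln Z′(T)| ≤ ½(C_S(a) + a_∞⁻¹)H²·|T|·ε_K²` (`K ≥ 1`, `|J_T| ≤ H`).
[cite: King1986, Thm 2.1 (2.22) p.654, (2.13)–(2.14) p.653, Lemma 4.3 (4.18) p.672] -/
theorem abs_log_kingBlockZ_sub_log_lim_le (hLodd : Odd L) (hL : 2 ≤ L) (ha : 0 < a) (hm : 0 < m2) {J : ∀ T : Torus221 (d + 1), Tor (t221Sites T) → ℝ}
    {H : ℝ} (hJ : ∀ T b, |J T b| ≤ H) (T : Torus221 (d + 1)) {K : ℕ} (hK : 1 ≤ K) :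
    |Real.log (kingBlockZ L a m2 J T K) - Real.log (kingBlockZlim L a m2 J T)|
      ≤ (symbolRateConst a L m2 + (aInf a L)⁻¹) * H ^ 2 / 2 * T.vol * eps L K ^ 2 := by
  haveI := t221Sites_neZero T
  have hL1 : (1 : ℝ) < L := by exact_mod_cast (show 1 < L by omega)
  have haI := aInf_pos ha hL1
  rw [log_kingBlockZ_sub_log_lim_eq L a m2 hLodd hL ha hm J T hK, abs_mul, abs_of_pos (by norm_num : (0 : ℝ) < 1 / 2), eps_sq, ← card_tor_t221Sites T]
  have hJJ : 0 ≤ J T ⬝ᵥ J T := Literature.LinearAlgebra.Matrix.dotProduct_self_nonneg_real _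
  have h1 := abs_fourierSum_sub_le L m2 (t221Sites T) hLodd hL ha hm hK (J T)
  have h2 := dotProduct_self_le_vol (t221Sites T) (hJ T)
  have hn : |((aK a L K)⁻¹ - (aInf a L)⁻¹) * (J T ⬝ᵥ J T)| = ((L : ℝ) ^ (2 * K))⁻¹ * (aInf a L)⁻¹ * (J T ⬝ᵥ J T) := by
    rw [abs_mul, abs_inv_aK_sub_inv_aInf L ha hL K, abs_of_nonneg hJJ]
  have hC := (symbolRateConst_pos L ha hL m2 hm).le
  calc (1 / 2 : ℝ) * |((aK a L K)⁻¹ - (aInf a L)⁻¹) * (J T ⬝ᵥ J T)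
          + ((Fintype.card (Tor (t221Sites T)) : ℝ)⁻¹ * ∑ q, Sfib (L ^ K) (t221Sites T) (((L ^ K : ℕ) : ℝ) ^ 2) m2 q * ‖ft (t221Sites T) (J T) q‖ ^ 2
            - (Fintype.card (Tor (t221Sites T)) : ℝ)⁻¹ * ∑ q, aliasSeries0 m2 (sOf (t221Sites T) q) * ‖ft (t221Sites T) (J T) q‖ ^ 2)|
      ≤ (1 / 2 : ℝ) * (((L : ℝ) ^ (2 * K))⁻¹ * (aInf a L)⁻¹ * (J T ⬝ᵥ J T)
          + symbolRateConst a L m2 * ((L : ℝ) ^ (2 * K))⁻¹ * (J T ⬝ᵥ J T)) := by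
        rw [← hn]
        exact mul_le_mul_of_nonneg_left ((abs_add_le _ _).trans (add_le_add le_rfl h1)) (by norm_num)
    _ = (1 / 2 : ℝ) * ((symbolRateConst a L m2 + (aInf a L)⁻¹) * ((L : ℝ) ^ (2 * K))⁻¹ * (J T ⬝ᵥ J T)) := by ring
    _ ≤ (1 / 2 : ℝ) * ((symbolRateConst a L m2 + (aInf a L)⁻¹) * ((L : ℝ) ^ (2 * K))⁻¹ * (H ^ 2 * Fintype.card (Tor (t221Sites T)))) := by gcongr
    _ = (symbolRateConst a L m2 + (aInf a L)⁻¹) * H ^ 2 / 2 * Fintype.card (Tor (t221Sites T)) * ((L : ℝ) ^ (2 * K))⁻¹ := by ring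

end BlockRate

end Summit.QuantumFields.YangMills.BalabanUVNodes.N15KingModelRung

end
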